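import Summits.Langlands.Langlands.Theorems.IrreducibilityBySelfDualityPairLBoundaryJS
import Summits.Langlands.Langlands.Theorems.IrreducibilityBySelfDualityPairLBoundaryJSSsv
import Summits.Langlands.Langlands.Theorems.IrreducibilityBySelfDualityPairLBoundaryJSStandardEntire
import Summits.Langlands.Langlands.Theorems.IrreducibilityBySelfDualityPairLBoundaryJSIsOrthoOfLocalTranslate
import Summits.Langlands.Langlands.Theorems.IrreducibilityBySelfDualityPairLBoundaryJSEqConjOfLocalTranslate
import Summits.Langlands.Langlands.Theorems.IrreducibilityBySelfDualityPairLBoundaryJSLocalPairTranslate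
import Summits.Langlands.Langlands.Theorems.IrreducibilityBySelfDualityPairLBoundaryJSOfHumphriesJo
import Summits.Langlands.Langlands.Theorems.IrreducibilityBySelfDualityPairLBoundaryJSCornerBochnerIwasawa
import Summits.Langlands.Langlands.Theorems.IrreducibilityBySelfDualityPairLBoundaryJSCornerPairTranslate
import Summits.Langlands.Langlands.Theorems.IrreducibilityBySelfDualityPairLBoundaryJSCornerPairEuler
import Summits.Langlands.Langlands.Theorems.IrreducibilityBySelfDualityPairLBoundaryJSCornerAbsMajorant
import Summits.Langlands.Langlands.Theorems.IrreducibilityBySelfDualityPairLBoundaryJSCornerAbsIdeleMoment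
import Summits.Langlands.Langlands.Theorems.IrreducibilityBySelfDualityPairLBoundaryJSCornerAbsTorusMajorant
import Summits.Langlands.Langlands.Theorems.IrreducibilityBySelfDualityPairLBoundaryJSCornerAbsConvergence
import Summits.Langlands.Langlands.Theorems.IrreducibilityBySelfDualityPairLBoundaryJSCornerEulerLimit
import Summits.Langlands.Langlands.Theorems.IrreducibilityBySelfDualityPairLBoundaryJSHonestTranslateUnramified
import Summits.Langlands.Langlands.Theorems.IrreducibilityBySelfDualityPairLBoundaryJSCornerGlobal
import Summits.Langlands.Langlands.Theorems.IrreducibilityBySelfDualityPairLBoundaryJSCornerArchFactorData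
import Summits.Langlands.Langlands.Theorems.IrreducibilityBySelfDualityPairLBoundaryJSCornerGlobalTranslate
import Summits.Langlands.Langlands.Theorems.IrreducibilityBySelfDualityPairLBoundaryJSCornerLocalSingleDatum
import Summits.Langlands.Langlands.Theorems.IrreducibilityBySelfDualityPairLBoundaryJSCornerLocalControlAsm
import Literature.NumberTheory.Automorphic.PairLFunctionMeromorphicContinuationRankNeTwistProofs
import Literature.NumberTheory.Automorphic.ArchRankinSelbergCornerTestVector
import Literature.NumberTheory.Automorphic.ClozelAlgebraicityComplexConjProofs
import Literature.NumberTheory.Automorphic.AutomorphicConjugate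
import Literature.NumberTheory.Automorphic.ArchRankinSelbergTestVector
import Literature.NumberTheory.Automorphic.JPSSGlobalIntegralQuotientUnfolding
import Literature.NumberTheory.Automorphic.JPSSCornerWhittakerUnfolding
import Literature.NumberTheory.Automorphic.WhittakerPeriodExchange
import Literature.NumberTheory.Automorphic.TorusIwasawaTransport
import Literature.NumberTheory.Automorphic.CornerTorusIwasawaData
import Literature.NumberTheory.Automorphic.WhittakerCoeffHonestCuspForm
import Literature.NumberTheory.Automorphic.WhittakerCoeffTranslateUnramified
import Literature.NumberTheory.Automorphic.WhittakerDecayCuspForm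
import Literature.NumberTheory.Automorphic.WhittakerSupportFinite
import Literature.NumberTheory.Automorphic.RankinSelbergUnramifiedTorus
import Literature.NumberTheory.Automorphic.RankinSelbergTorusPairEuler
import Literature.NumberTheory.Automorphic.RankinSelbergTowerFiniteness

/-!
# Crux `PairLBoundaryJS` (stmt-Langlands-13622), line `Sketch` — the crux from THREE named inputs by the
# CORNER ROAD (lead c5)

Summit `Langlands`, sub-problem `Langlands`, helper file under `Theorems/` supporting the crux
`PairLBoundaryJS` = Arthur–Clozel (1989), Ch. 3, (2.2) for cuspidal Borel–Jacquet data on `GL_n × GL_m`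
over a number field, all ranks. This is the line's skeleton v16 with every engineering stub LANDED, so that
the composition `PairLBoundaryJS_of_moeglinWaldspurger_of_isOrtho hA hC hB` (p81600) is an honest CONDITIONAL
theorem on exactly three printed inputs:

* `hMW` — Mœglin–Waldspurger (1989), Appendice, Corollaire (i)(a) for `m + 2 ≤ n` (`L^S(s, π × σ)` entire;
  Cogdell (2004) Thm. 4.2 by the JPSS global integrals WITH the projector `ℙⁿ_m` — not in the tree);
* `hHJ` — the archimedean named fact `HumphriesJo2024_archRankinSelberg_testVector` (equal ranks);
* `hJ` — the archimedean named fact `JacquetArchimedeanRS2009_archRankinSelbergCorner_testVector` (Jacquet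
  (2009), Thm. 2.7 (i): ranks `(m+1, m)`).

New with respect to `PairLBoundaryJSOfHumphriesJo` (lead c3, inputs `{(i)(a) for 2 ≤ n ≠ m, hHJ}`): the case
`n = m + 1` (and `m = n + 1`) of (i)(a) is PROVED granted `hJ`, by the corner road — the JPSS corner integrals
`I(s; φ, φ')` on honest cusp forms (`JPSSGlobalIntegral`: entire), unfolded (`CornerGlobal`), Euler-factorised
(`CornerPairEuler`, `CornerEulerLimit`, `HonestTranslateUnramified`), absolutely convergent (`CornerAbs*`), in
translate form (`CornerGlobalTranslate`), with the bad-place and archimedean local control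
(`CornerUnitBoxProductForm`, `CornerLocalSingleDatum`, `CornerArchFactorData`, `CornerLocalControlAsm`):
`corner_entire_quotient_of_local_control` gives, for every pair and every `s₀`, entire `J`, `A` with `A(s₀) ≠ 0` and
`J = A · L^{S₀}` on a right half-plane, which the tree's bookkeeping
`MoeglinWaldspurger1989_partialPairL_entire_of_rank_ne_of_entire_quotients` turns into (i)(a) at `(m+1, m)`.
-/

noncomputable section

-- `Summit.Langlands.Langlands.…` (summit = sub-problem name, D-0017 layout) trips `dupNamespace`
set_option linter.dupNamespace false

open scoped MatrixGroups Topology Pointwise ENNReal NNReal ComplexConjugate InnerProductSpace ContDiff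
-- the place subtypes indexing `mixedSpace K` are `Fintype` classically (`NormedCommRing (mixedSpace K)`)
open scoped Classical Matrix.Norms.Operator
open NumberField IsDedekindDomain MeasureTheory Measure Matrix Set Filter WithZero
open NumberField.mixedEmbedding
open Literature.NumberTheory.Automorphic AdelicGroupData
open Literature.NumberTheory.GaloisRepresentations (ideleGroup HeckeCharacter)
open Literature.MeasureTheory.Group
open Literature.RingTheory.SymmetricFunctions.SymmPoly
open ValuativeRel

-- the automorphic quotient carries the tree's Borel σ-algebra, not Mathlib's quotient σ-algebra
attribute [-instance] Quotient.instMeasurableSpace QuotientGroup.measurableSpace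

-- the house local instances, exactly as in `RankinSelbergUnfoldingIdentity`
attribute [local instance] adelicBorel borelSpace_adelic locallyCompactSpace_adelic secondCountableTopology_gl_adelic
  glAdeleBorel borelSpace_glAdele borelSpace_ideleGroup secondCountableTopology_ideleGroup

-- Mathlib idiom: the commutator Lie ring on matrices, to mention `(archGroupGL n K).lie`
attribute [local instance 100] LieRing.ofAssociativeRing

namespace Summit.Langlands.Langlands.Theorems.PairLBoundaryJSOfCornerRoad

/-- **The corner heart from the global translate theorem and the local control, granted the archimedean
fact of Jacquet (2009).** For cuspidal `π` on `GL_{m+1}`, `σ` on `GL_m` (`0 < m`), a finite `S₀` off which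
both are unramified, Satake families `α₀`, `β₀` off `S₀` and any `s₀`: `J := Λ(s - 1/2) Σ_i c_i I(s; Φ_i, Φ̄'_i)`
is entire (`differentiable_jpssIntegral_of_isCuspFormGL`, `IsCuspFormGL.star`), `A := C · w_{s-1/2}(τ)` is entire
and zero-free (`differentiable_torusWeightC`, `torusWeightC_ne_zero`), and `J = A · L^{S₀}(s, α₀ ⊗ β₀)` on a right
half-plane by `stub_corner_global_translate` at `(π, σ̄, γ = β̄₀)` (`IsSatakeFamilyOf.conj`,
`isUnramifiedAt_conj_iff`, `multiset_map_conj_map_conj`, enumerations `exists_univ_val_map_eq`) and the local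
identity of `stub_corner_local_control` at the parameter `s - 1/2`. [cite: CogdellAnalyticTheory2004, Thm. 4.2 and §4.2] -/
theorem corner_entire_quotient_of_local_control
    (hJ : ∀ (N : ℕ) (K : Type) [Field K] [NumberField K],
      JacquetArchimedeanRS2009_archRankinSelbergCorner_testVector N K) :
    ∀ {m : ℕ} {K : Type} [Field K] [NumberField K]
      {μ : Measure (gl (m + 1) K).automorphicQuotient} [(gl (m + 1) K).IsAutomorphicMeasure μ]
      {μ' : Measure (gl m K).automorphicQuotient} [(gl m K).IsAutomorphicMeasure μ']
      (_hm : 0 < m) (P : CuspidalAutomorphicRepGL (m + 1) K μ) (P' : CuspidalAutomorphicRepGL m K μ')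
      (S₀ : Finset (HeightOneSpectrum (𝓞 K)))
      (_hS₀ : ∀ v ∉ S₀, IsUnramifiedAt P.1 v ∧ IsUnramifiedAt P'.1 v)
      {α₀ β₀ : SatakeFamily K} (_hα₀ : IsSatakeFamilyOf P (↑S₀ : Set (HeightOneSpectrum (𝓞 K))) α₀)
      (_hβ₀ : IsSatakeFamilyOf P' (↑S₀ : Set (HeightOneSpectrum (𝓞 K))) β₀) (s₀ : ℂ),
      ∃ (x₀ : ℝ) (J A : ℂ → ℂ), Differentiable ℂ J ∧ Differentiable ℂ A ∧ A s₀ ≠ 0 ∧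
        ∀ s : ℂ, x₀ < s.re → J s = A s * partialPairL (↑S₀ : Set (HeightOneSpectrum (𝓞 K))) α₀ β₀ s := by
  intro m K _ _ μ _ μ' _ hm P P' S₀ hS₀ α₀ β₀ hα₀ hβ₀ s₀
  classical
  -- instances, as in `IsOrthoOfLocalTranslate.stub_isOrtho_of_local_translate`
  haveI : T2Space (AdeleRing (𝓞 K) K) := t2Space_adeleRing K
  letI : MeasurableSpace (AdeleRing (𝓞 K) K) := borel _
  haveI : BorelSpace (AdeleRing (𝓞 K) K) := ⟨rfl⟩
  haveI := borelSpace_ideleGroup K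
  haveI := locallyCompactSpace_ideleGroup K
  haveI := secondCountableTopology_ideleGroup K
  haveI := secondCountableTopology_adeleRing K
  haveI := locallyCompactSpace_adeleRing' K
  haveI : T2Space (GL (Fin (m + 1)) (AdeleRing (𝓞 K) K)) := t2Space_gl (m + 1) K
  haveI : T2Space (GL (Fin m) (AdeleRing (𝓞 K) K)) := t2Space_gl m K
  haveI : LocallyCompactSpace (GL (Fin (m + 1)) (AdeleRing (𝓞 K) K)) :=
    AdelicGroupData.locallyCompactSpace_generalLinearGroup_adeleRing K (Fin (m + 1))
  haveI : LocallyCompactSpace (GL (Fin m) (AdeleRing (𝓞 K) K)) :=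
    AdelicGroupData.locallyCompactSpace_generalLinearGroup_adeleRing K (Fin m)
  haveI := secondCountableTopology_generalLinearGroup_adeleRing K (Fin (m + 1))
  haveI := secondCountableTopology_generalLinearGroup_adeleRing K (Fin m)
  haveI : CompactSpace ↥(maximalCompactAdelic m K) :=
    isCompact_iff_compactSpace.1 (isCompact_maximalCompactAdelic m K)
  haveI : LocallyCompactSpace ↥(adelicUnipotent (m + 1) K) := (isClosed_adelicUnipotent (m + 1) K).locallyCompactSpace
  haveI : LocallyCompactSpace ↥(adelicUnipotent m K) := (isClosed_adelicUnipotent m K).locallyCompactSpace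
  -- Haar measures
  obtain ⟨νA, hνA⟩ : ∃ ν : Measure (Fin m → ideleGroup K), IsHaarMeasure ν := ⟨Measure.haar, inferInstance⟩
  obtain ⟨νK, hνK⟩ : ∃ ν : Measure ↥(maximalCompactAdelic m K), IsHaarMeasure ν := ⟨Measure.haar, inferInstance⟩
  obtain ⟨ν₀, hν₀⟩ : ∃ ν : Measure ↥(adelicUnipotent (m + 1) K), IsHaarMeasure ν := ⟨Measure.haar, inferInstance⟩
  obtain ⟨ν₀', hν₀'⟩ : ∃ ν : Measure ↥(adelicUnipotent m K), IsHaarMeasure ν := ⟨Measure.haar, inferInstance⟩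
  -- `π` and `σ̄` are unramified off `S₀`
  have hU : ∀ v ∉ S₀, IsUnramifiedAt P.1 v ∧ IsUnramifiedAt P'.conj.1 v := fun v hv =>
    ⟨(hS₀ v hv).1, isUnramifiedAt_conj_iff.2 (hS₀ v hv).2⟩
  -- the local control datum at `(π, σ̄, S₀)`
  obtain ⟨τ, hτψ, k, c, Φ, Φ', sv, sv', 𝔫₀, h𝔫₀, h𝔫₀S, hΦc, hΦ'c, hae, hae', hΦcusp, hΦ'cusp, hΦU, hΦ'U,
    Λ, x₁, hΛ, hΛsum⟩ := CornerLocalControlAsm.stub_corner_local_control hJ hm νA νK ν₀ ν₀' P P'.conj S₀ hU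
  -- the global translate theorem
  obtain ⟨C, hC, hT⟩ := CornerGlobalTranslate.stub_corner_global_translate hm μ μ' νA νK ν₀ ν₀'
  have hS' : ∀ v ∉ (↑S₀ : Set (HeightOneSpectrum (𝓞 K))), ¬ v.asIdeal ∣ 𝔫₀ := fun v hv h =>
    hv (Finset.mem_coe.2 (h𝔫₀S v h))
  -- enumerations of the Satake parameters of `π`, `σ̄` off `S₀`
  have hexx : ∀ v : HeightOneSpectrum (𝓞 K), ∃ x : Fin (m + 1) → ℂ, v ∉ (↑S₀ : Set (HeightOneSpectrum (𝓞 K))) →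
      (Finset.univ : Finset (Fin (m + 1))).val.map x = α₀ v := by
    intro v
    by_cases hv : v ∉ (↑S₀ : Set (HeightOneSpectrum (𝓞 K)))
    · obtain ⟨x, hx⟩ := exists_univ_val_map_eq (hα₀.card_eq hv)
      exact ⟨x, fun _ => hx⟩
    · exact ⟨fun _ => 0, fun h => absurd h hv⟩
  have hexy : ∀ v : HeightOneSpectrum (𝓞 K), ∃ y : Fin m → ℂ, v ∉ (↑S₀ : Set (HeightOneSpectrum (𝓞 K))) →
      (Finset.univ : Finset (Fin m)).val.map y = (β₀ v).map conj := by
    intro v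
    by_cases hv : v ∉ (↑S₀ : Set (HeightOneSpectrum (𝓞 K)))
    · obtain ⟨y, hy⟩ := exists_univ_val_map_eq (R := ℂ) (m := m) (α := (β₀ v).map conj)
        (by rw [Multiset.card_map]; exact hβ₀.card_eq hv)
      exact ⟨y, fun _ => hy⟩
    · exact ⟨fun _ => 0, fun h => absurd h hv⟩
  choose x hx using hexx
  choose y hy using hexy
  have hββ : (fun v => ((β₀ v).map conj).map conj) = β₀ := funext fun v => multiset_map_conj_map_conj _
  -- the strip identities, one for each datum
  choose xf hxf using fun i : Fin k =>
    hT P P'.conj hα₀ hβ₀.conj (hΦc i) (hΦ'c i) (sv i) (sv' i) (hae i) (hae' i) (hΦcusp i) (hΦ'cusp i) h𝔫₀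
      (hΦU i) (hΦ'U i) Set.Subset.rfl hS' τ (fun v hv => hτψ v fun h => hv (Finset.mem_coe.2 h)) hx hy
  -- the entire functions
  set xmax : ℝ := (∑ i, |xf i|) + |x₁| + 1 with hxmax
  have hC0 : (C : ℂ) ≠ 0 := Complex.ofReal_ne_zero.2 hC.ne'
  refine ⟨xmax, fun s => Λ (s - 1 / 2) * ∑ i, c i * jpssIntegral (Nat.lt_succ_self m) μ' (Φ i) (star (Φ' i)) s,
    fun s => (C : ℂ) * torusWeightC m K (s - 1 / 2) τ, ?_, ?_, ?_, ?_⟩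
  · -- `J` is entire
    have hΛ' : Differentiable ℂ fun s : ℂ => Λ (s - 1 / 2) := hΛ.comp (differentiable_id.sub_const _)
    have hI : ∀ i, Differentiable ℂ (jpssIntegral (Nat.lt_succ_self m) μ' (Φ i) (star (Φ' i))) := fun i =>
      (differentiable_jpssIntegral_of_isCuspFormGL (μ' := μ') hm (Nat.lt_succ_self m) (hΦcusp i)
        (φ' := star (Φ' i)) (hΦ'cusp i).star).1
    have hsum : Differentiable ℂ fun s => ∑ i, c i * jpssIntegral (Nat.lt_succ_self m) μ' (Φ i) (star (Φ' i)) s := by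
      have h : Differentiable ℂ (∑ i, fun s => c i * jpssIntegral (Nat.lt_succ_self m) μ' (Φ i) (star (Φ' i)) s) :=
        Differentiable.sum fun i _ => (hI i).const_mul (c i)
      convert h using 1
      funext s
      simp only [Finset.sum_apply]
    exact hΛ'.mul hsum
  · -- `A` is entire
    exact ((differentiable_torusWeightC τ).comp (differentiable_id.sub_const _)).const_mul _
  · -- `A s₀ ≠ 0`
    exact mul_ne_zero hC0 (torusWeightC_ne_zero _ τ)
  · -- the identity on `re s > xmax`
    intro s hs
    have habs : ∀ i, xf i < s.re := fun i => by
      have h1 : xf i ≤ |xf i| := le_abs_self _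
      have h2 : |xf i| ≤ ∑ j, |xf j| := Finset.single_le_sum (fun j _ => abs_nonneg (xf j)) (Finset.mem_univ i)
      have h3 : (0 : ℝ) ≤ |x₁| := abs_nonneg _
      linarith
    have hs₁ : x₁ < (s - 1 / 2).re := by
      have h1 : x₁ ≤ |x₁| := le_abs_self _
      have h2 : (0 : ℝ) ≤ ∑ j, |xf j| := Finset.sum_nonneg fun j _ => abs_nonneg (xf j)
      simp only [Complex.sub_re, Complex.div_ofNat_re, Complex.one_re]
      linarith
    have hloc := hΛsum (s - 1 / 2) hs₁
    -- each global integral on the half-plane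
    have hterm : ∀ i, jpssIntegral (Nat.lt_succ_self m) μ' (Φ i) (star (Φ' i)) s =
        (C : ℂ) * (torusWeightC m K (s - 1 / 2) τ *
          (partialPairL (↑S₀ : Set (HeightOneSpectrum (𝓞 K))) α₀ β₀ s *
            ∫ p in unitBox {v | v ∉ (↑S₀ : Set (HeightOneSpectrum (𝓞 K)))} ×ˢ Set.univ, torusPairIntegrandC m K
              (fun g => whittakerCoeff ν₀ (unipotentTateDomain (m + 1) K) (adeleAddChar K)
                (invQuot (AdelicGroupData.gl (m + 1) K) (Φ i))
                (glDiagonal (m + 1) (AdeleRing (𝓞 K) K) (Fin.snoc τ 1) * glCorner (AdeleRing (𝓞 K) K) (Nat.le_succ m) g))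
              (fun g => star (whittakerCoeff ν₀' (unipotentTateDomain m K) (adeleAddChar K)
                (invQuot (AdelicGroupData.gl m K) (Φ' i)) (glDiagonal m (AdeleRing (𝓞 K) K) τ * g)))
              (fun _ => (1 : ℝ)) (s - 1 / 2) p ∂(νA.prod νK))) := by
      intro i
      have h := hxf i s (habs i)
      rw [hββ] at h
      exact h
    simp_rw [hterm]
    -- `Λ · ∑ c_i (C w L Ψ_i) = C w L · (Λ ∑ c_i Ψ_i) = C w L`
    have hre : ∑ i, c i * ((C : ℂ) * (torusWeightC m K (s - 1 / 2) τ *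
        (partialPairL (↑S₀ : Set (HeightOneSpectrum (𝓞 K))) α₀ β₀ s *
          ∫ p in unitBox {v | v ∉ (↑S₀ : Set (HeightOneSpectrum (𝓞 K)))} ×ˢ Set.univ, torusPairIntegrandC m K
            (fun g => whittakerCoeff ν₀ (unipotentTateDomain (m + 1) K) (adeleAddChar K)
              (invQuot (AdelicGroupData.gl (m + 1) K) (Φ i))
              (glDiagonal (m + 1) (AdeleRing (𝓞 K) K) (Fin.snoc τ 1) * glCorner (AdeleRing (𝓞 K) K) (Nat.le_succ m) g))
            (fun g => star (whittakerCoeff ν₀' (unipotentTateDomain m K) (adeleAddChar K)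
              (invQuot (AdelicGroupData.gl m K) (Φ' i)) (glDiagonal m (AdeleRing (𝓞 K) K) τ * g)))
            (fun _ => (1 : ℝ)) (s - 1 / 2) p ∂(νA.prod νK)))) =
      (C : ℂ) * torusWeightC m K (s - 1 / 2) τ * partialPairL (↑S₀ : Set (HeightOneSpectrum (𝓞 K))) α₀ β₀ s *
        ∑ i, c i * ∫ p in unitBox {v | v ∉ (↑S₀ : Set (HeightOneSpectrum (𝓞 K)))} ×ˢ Set.univ, torusPairIntegrandC m K
            (fun g => whittakerCoeff ν₀ (unipotentTateDomain (m + 1) K) (adeleAddChar K)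
              (invQuot (AdelicGroupData.gl (m + 1) K) (Φ i))
              (glDiagonal (m + 1) (AdeleRing (𝓞 K) K) (Fin.snoc τ 1) * glCorner (AdeleRing (𝓞 K) K) (Nat.le_succ m) g))
            (fun g => star (whittakerCoeff ν₀' (unipotentTateDomain m K) (adeleAddChar K)
              (invQuot (AdelicGroupData.gl m K) (Φ' i)) (glDiagonal m (AdeleRing (𝓞 K) K) τ * g)))
            (fun _ => (1 : ℝ)) (s - 1 / 2) p ∂(νA.prod νK) := by
      rw [Finset.mul_sum]
      refine Finset.sum_congr rfl fun i _ => ?_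
      ring
    rw [hre]
    linear_combination ((C : ℂ) * torusWeightC m K (s - 1 / 2) τ *
      partialPairL (↑S₀ : Set (HeightOneSpectrum (𝓞 K))) α₀ β₀ s) * hloc


/-! ## Mœglin–Waldspurger (i)(a) at `n = m + 1`, then at all ranks, then the crux -/

/-- **The corner case `n = m + 1` of Mœglin–Waldspurger (i)(a)**, granted the archimedean fact of Jacquet (2009):
from `corner_entire_quotient_of_local_control` — the ramified set `S₀` of the pair with its canonical Satake families
(`exists_isSatakeFamilyOf_pair_ramified`), the abscissa made uniform (`x₀ := 1`) by the identity theorem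
(`eqOn_halfPlane_of_eqOn_right`, `differentiableOn_partialPairL_of_isSatakeFamilyOf`), then
`MoeglinWaldspurger1989_partialPairL_entire_of_rank_ne_of_entire_quotients`.
[cite: MoeglinWaldspurger1989, Appendice, Corollaire (i)(a), p. 667] [cite: CogdellAnalyticTheory2004, Thm. 4.2 and §4.2] -/
theorem partialPairL_entire_of_rank_succ
    (hJ : ∀ (N : ℕ) (K : Type) [Field K] [NumberField K],
      JacquetArchimedeanRS2009_archRankinSelbergCorner_testVector N K) {m : ℕ} {K : Type} [Field K] [NumberField K]
    {μ : Measure (gl (m + 1) K).automorphicQuotient} [(gl (m + 1) K).IsAutomorphicMeasure μ]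
    {μ' : Measure (gl m K).automorphicQuotient} [(gl m K).IsAutomorphicMeasure μ'] :
    MoeglinWaldspurger1989_partialPairL_entire_of_rank_ne (n := m + 1) (m := m) (K := K) (μ := μ)
      (μ' := μ') := by
  refine MoeglinWaldspurger1989_partialPairL_entire_of_rank_ne_of_entire_quotients fun _hnm _hn hm P P' => ?_
  classical
  -- the ramified set of the pair and the canonical Satake families off it
  obtain ⟨α₀, β₀, hα₀', hβ₀'⟩ := exists_isSatakeFamilyOf_pair_ramified P P'
  have hS₀f : {v : HeightOneSpectrum (𝓞 K) | ¬ IsUnramifiedAt P.1 v ∨ ¬ IsUnramifiedAt P'.1 v}.Finite :=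
    finite_setOf_not_isUnramifiedAt_or P P'
  obtain ⟨S₀, hcoe⟩ : ∃ S₀ : Finset (HeightOneSpectrum (𝓞 K)),
      (↑S₀ : Set (HeightOneSpectrum (𝓞 K))) = {v | ¬ IsUnramifiedAt P.1 v ∨ ¬ IsUnramifiedAt P'.1 v} :=
    ⟨hS₀f.toFinset, hS₀f.coe_toFinset⟩
  have hmemS₀ : ∀ v : HeightOneSpectrum (𝓞 K), v ∈ S₀ ↔ ¬ IsUnramifiedAt P.1 v ∨ ¬ IsUnramifiedAt P'.1 v :=
    fun v => by rw [← Finset.mem_coe, hcoe, Set.mem_setOf_eq]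
  have hα₀ : IsSatakeFamilyOf P (↑S₀ : Set (HeightOneSpectrum (𝓞 K))) α₀ := hα₀'.mono hcoe.symm.subset
  have hβ₀ : IsSatakeFamilyOf P' (↑S₀ : Set (HeightOneSpectrum (𝓞 K))) β₀ := hβ₀'.mono hcoe.symm.subset
  have hram : ∀ v ∈ (↑S₀ : Set (HeightOneSpectrum (𝓞 K))), ¬ IsUnramifiedAt P.1 v ∨ ¬ IsUnramifiedAt P'.1 v :=
    fun v hv => (hmemS₀ v).1 (Finset.mem_coe.1 hv)
  have hU : ∀ v ∉ S₀, IsUnramifiedAt P.1 v ∧ IsUnramifiedAt P'.1 v := fun v hv =>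
    ⟨of_not_not fun h => hv ((hmemS₀ v).2 (Or.inl h)), of_not_not fun h => hv ((hmemS₀ v).2 (Or.inr h))⟩
  refine ⟨↑S₀, α₀, β₀, hram, hα₀, hβ₀, 1, fun s₀ => ?_⟩
  obtain ⟨x₀, J, A, hJ, hA, hA0, hJA⟩ := corner_entire_quotient_of_local_control hJ hm P P' S₀ hU hα₀ hβ₀ s₀
  refine ⟨J, A, hJ, hA, hA0, ?_⟩
  -- uniform abscissa: `J = A · L^{S₀}` on `re s > max x₀ 1`, hence on `re s > 1` by the identity theorem
  have hL := differentiableOn_partialPairL_of_isSatakeFamilyOf P P' hα₀ hβ₀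
  have hAL : DifferentiableOn ℂ (fun s => A s * partialPairL (↑S₀ : Set (HeightOneSpectrum (𝓞 K))) α₀ β₀ s)
      {s : ℂ | 1 < s.re} := hA.differentiableOn.mul hL
  exact eqOn_halfPlane_of_eqOn_right hJ hAL (le_max_right x₀ 1)
    fun s hs => hJA s (lt_of_le_of_lt (le_max_left _ _) hs)


/-- **Mœglin–Waldspurger (1989), Appendice, Corollaire (i)(a) at all ranks from its `m + 2 ≤ n` cases and the
archimedean fact of Jacquet (2009)**: `(n,1)` and `(1,n)` by the LANDED standard-`L` slices
(`StandardEntire.stub_standard_entire_of_ssv Ssv.stub_ssv`), `n = m + 1` / `m = n + 1` by the corner road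
(`partialPairL_entire_of_rank_succ` and `…_of_swap`), `|n - m| ≥ 2` by the hypothesis (and `…_of_swap`).
[cite: MoeglinWaldspurger1989, Appendice, Corollaire (i)(a), p. 667] [cite: CogdellAnalyticTheory2004, Thm. 4.2 and §4.2] -/
theorem partialPairL_entire_of_rank_ne_of_gap
    (hMW : ∀ {n m : ℕ} {K : Type} [Field K] [NumberField K]
      {μ : Measure (gl n K).automorphicQuotient} [(gl n K).IsAutomorphicMeasure μ]
      {μ' : Measure (gl m K).automorphicQuotient} [(gl m K).IsAutomorphicMeasure μ'],
      m + 2 ≤ n →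
      MoeglinWaldspurger1989_partialPairL_entire_of_rank_ne (n := n) (m := m) (K := K) (μ := μ) (μ' := μ'))
    (hJ : ∀ (N : ℕ) (K : Type) [Field K] [NumberField K],
      JacquetArchimedeanRS2009_archRankinSelbergCorner_testVector N K)
    {n m : ℕ} {K : Type} [Field K] [NumberField K]
    {μ : Measure (gl n K).automorphicQuotient} [(gl n K).IsAutomorphicMeasure μ]
    {μ' : Measure (gl m K).automorphicQuotient} [(gl m K).IsAutomorphicMeasure μ'] :
    MoeglinWaldspurger1989_partialPairL_entire_of_rank_ne (n := n) (m := m) (K := K) (μ := μ)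
      (μ' := μ') := by
  intro hnm hn hm P P' S hS α β hα hβ
  rcases Nat.lt_or_ge m 2 with hm2 | hm2
  · obtain rfl : m = 1 := by omega
    exact MoeglinWaldspurger1989_partialPairL_entire_of_rank_ne_gl_one_of_standard
      (fun Q _ hS' _ hγ => StandardEntire.stub_standard_entire_of_ssv Ssv.stub_ssv (by omega) Q hS' hγ)
      hnm hn hm P P' hS hα hβ
  rcases Nat.lt_or_ge n 2 with hn2 | hn2
  · obtain rfl : n = 1 := by omega
    exact MoeglinWaldspurger1989_partialPairL_entire_of_rank_ne_of_swap
      (MoeglinWaldspurger1989_partialPairL_entire_of_rank_ne_gl_one_of_standard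
        (fun Q _ hS' _ hγ => StandardEntire.stub_standard_entire_of_ssv Ssv.stub_ssv (by omega) Q hS' hγ))
      hnm hn hm P P' hS hα hβ
  rcases lt_or_gt_of_ne hnm with hlt | hgt
  · refine MoeglinWaldspurger1989_partialPairL_entire_of_rank_ne_of_swap ?_ hnm hn hm P P' hS hα hβ
    rcases Nat.lt_or_ge m (n + 2) with h1 | h1
    · obtain rfl : m = n + 1 := by omega
      exact partialPairL_entire_of_rank_succ hJ
    · exact hMW h1
  · rcases Nat.lt_or_ge n (m + 2) with h1 | h1
    · obtain rfl : n = m + 1 := by omega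
      exact partialPairL_entire_of_rank_succ hJ hnm hn hm P P' hS hα hβ
    · exact hMW h1 hnm hn hm P P' hS hα hβ

/-- **The crux `PairLBoundaryJS` (Arthur–Clozel (2.2) for Borel–Jacquet data, all ranks) from THREE named
inputs**: Mœglin–Waldspurger (i)(a) for `m + 2 ≤ n` (`hMW`), the equal-rank archimedean fact of Humphries–Jo
(`hHJ`, through the LANDED `PairLBoundaryJSOfHumphriesJo.partialPairL_of_eq_conj_of_humphriesJo` and
`…partialPairL_entire_of_isOrtho_of_humphriesJo`) and the corner archimedean fact of Jacquet (`hJ`); the rest —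
the `(n,1)`, `(1,n)`, `(m+1,m)`, `(m,m+1)` slices of (i)(a), Corollaire (ii), the orthogonal-pair continuation
and the Schur/Landau assembly `PairLBoundaryJS_of_moeglinWaldspurger_of_isOrtho` — is proved in the tree.
[cite: ArthurClozelAMS120, Ch. 3 §2 (2.2)] [cite: JacquetShalikaAJM1981II, Prop. 3.6 and Thm. 4.4]
[cite: MoeglinWaldspurger1989, Appendice, Corollaire (i)(a), (i)(b), (ii), p. 667] -/
theorem stub_PairLBoundaryJS_of_gap_of_humphriesJo_of_jacquet :
    (∀ {n m : ℕ} {K : Type} [Field K] [NumberField K]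
      {μ : Measure (gl n K).automorphicQuotient} [(gl n K).IsAutomorphicMeasure μ]
      {μ' : Measure (gl m K).automorphicQuotient} [(gl m K).IsAutomorphicMeasure μ'],
      m + 2 ≤ n →
      MoeglinWaldspurger1989_partialPairL_entire_of_rank_ne (n := n) (m := m) (K := K) (μ := μ) (μ' := μ')) →
    (∀ (N : ℕ) (K : Type) [Field K] [NumberField K], HumphriesJo2024_archRankinSelberg_testVector N K) →
    (∀ (N : ℕ) (K : Type) [Field K] [NumberField K],
      JacquetArchimedeanRS2009_archRankinSelbergCorner_testVector N K) →
    Summit.Langlands.Langlands.Theses.IrreducibilityBySelfDuality.PairLBoundaryJS :=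
  fun hMW hHJ hJ =>
    PairLBoundaryJS_of_moeglinWaldspurger_of_isOrtho (partialPairL_entire_of_rank_ne_of_gap hMW hJ)
      (PairLBoundaryJSOfHumphriesJo.partialPairL_of_eq_conj_of_humphriesJo hHJ)
      (PairLBoundaryJSOfHumphriesJo.partialPairL_entire_of_isOrtho_of_humphriesJo hHJ)

end Summit.Langlands.Langlands.Theorems.PairLBoundaryJSOfCornerRoad

end
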